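import Mathlib
import Literature.Computability.Complexity.Circuit
import Literature.Computability.Complexity.CircuitSemantics
import HarnessLib

/-!
# Nechiporuk's subfunction count for monotone formulas (straight-line model, crude constant)

Nechiporuk's method (E. I. Nechiporuk 1966; S. Jukna, *Boolean Function Complexity* (2012),
Thm. 6.16) bounds the size of a formula computing `f` from below by the number of distinct
*subfunctions* of `f` on disjoint blocks of variables. This file proves the version of the
counting lemma that is needed for monotone formula lower bounds in the tree's straight-line
model `Literature.Computability.Complexity.Circuit` (formulas = circuits with `IsFormula`, i.e. every
gate is referenced at most once; size = number of gates; basis `monotoneBasis = {∧₂, ∨₂}`).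

Subfunction measure (first part, independent of circuits):

* `subfnRestrict Y ρ g` — the restriction of `g` fixing the variables outside the block `Y` to `ρ`
  (kept as a function of all variables that ignores those outside `Y`);
* `subfnClosure Y g` — the finite set of all restrictions together with the two constants;
* `subfnMeasure Y g` — the measure `ψ_Y(g) = |subfnClosure Y g|`, replaced by `1` when every
  restriction of `g` on `Y` is constant;
* `subfnMeasure_binop_le` — **`ψ_Y(g ⋄ h) ≤ ψ_Y(g) · ψ_Y(h)`** for `⋄ ∈ {∧, ∨}` (any connective with
  `b ⋄ b = b` whose sections at constants are constant or the identity): the heart of the method —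
  if all restrictions of `h` are constant then `g ⋄ h` restricts to `0`, `1` or a restriction of `g`;
* `subfnMeasure_proj_le`, `subfnMeasure_proj_of_not_mem` — a variable has measure `≤ 3`, and `1`
  off its block; `card_le_subfnMeasure_of_injective` — an injective family of restrictions bounds
  `ψ_Y` from below.

Counting lemma (second part):

* `Circuit.wireFn C w` — the Boolean function carried by a wire; `Circuit.unusedBelow C m` — the set
  `U_m` of gates `< m` not referenced by any gate `< m`;
* `Circuit.blockMeasure`, `Circuit.blockPotential` — `Ψ(w) = ∏ₖ ψ_{Y_k}(w)` and `Φ_m = ∏_{U_m} Ψ`;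
* `Circuit.prod_subfnMeasure_eval_le` — **the counting lemma**: for a formula `C` over `{∧₂, ∨₂}`
  and pairwise disjoint blocks `Y_k = blk⁻¹(k)`,  `∏ₖ ψ_{Y_k}(C.eval) ≤ 3 ^ (2 · C.size + 1)`, i.e.
  `Σₖ log₃ ψ_{Y_k}(f) ≤ 2 · size + 1`.

The proof of the counting lemma is a potential argument over the straight-line program rather
than over the formula tree: `Φ_{m+1} ≤ 9 · Φ_m` (`Circuit.blockPotential_succ_le`), because gate `m`
consumes its (at most two, distinct, previously unreferenced — this is where `IsFormula` enters,
through the reference counts `Circuit.IsFormula.false_of_ref_ref` / `false_of_two_slots`) gate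
arguments (`Ψ(u ⋄ v) ≤ Ψ(u) Ψ(v)`) and each variable argument costs a factor `≤ 3`; the output gate
`o` lies in `U_{o+1}`, whence `Ψ(o) ≤ Φ_{o+1} ≤ 9 ^ size`. The constant is cruder than Jukna's `¼`
(leaf-size, binary basis) but suffices for `Ω`-statements such as the `Ω(n² d)` monotone formula
bound for orthogonal vectors (`Literature/Computability/FineGrained/MonotoneOV.lean`). The general
binary-basis statement with Jukna's constant is the named fact
`Literature.Barriers.PneNP.Nechiporuk1966` (neither used nor discharged here); the barrier file
`Literature/Barriers/PneNP/Nechiporuk.lean` counts subfunctions as functions on the subtype `Y`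
(`numSubfunctions`), while the bookkeeping here stays on the full cube, which is what the potential
argument needs.

## References

* [Jukna2012] S. Jukna, *Boolean Function Complexity*, Springer 2012, §6.5, Thm. 6.16
  (PDF pp. 188–189).
* [arXiv260723799] T. Choudhury, N. Limaye, K. Sreenivasaiah, S. Srinivasan, *New and Improved
  Concrete Lower Bounds for Orthogonal Vectors*, arXiv:2607.23799 (2026), Thm. 24 (the method as
  used there).
* [AroraBarak2009] S. Arora, B. Barak, *Computational Complexity* (2009), Rem. 6.4 (straight-line
  programs).
-/

noncomputable section

open Classical

namespace Literature.Computability.Complexity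

open Finset

universe u

variable {ι : Type u}

/-! ### Restrictions to a block and the subfunction measure -/

/-- The restriction of `g` to the block `Y`: the variables outside `Y` are fixed to `ρ`, those in
`Y` are read from the argument (a *subfunction* of `g` on `Y`, Jukna 2012, §6.5, kept as a function
of all variables that ignores the coordinates outside `Y`). [cite: Jukna2012, §6.5 (PDF p. 188)] -/
def subfnRestrict (Y : Set ι) (ρ : ι → Bool) (g : (ι → Bool) → Bool) : (ι → Bool) → Bool :=
  fun x => g fun i => if i ∈ Y then x i else ρ i

/-- Unfolding `subfnRestrict`. [folklore] -/
theorem subfnRestrict_apply (Y : Set ι) (ρ : ι → Bool) (g : (ι → Bool) → Bool) (x : ι → Bool) :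
    subfnRestrict Y ρ g x = g (fun i => if i ∈ Y then x i else ρ i) := rfl

/-- Restriction commutes with pointwise binary operations. [folklore] -/
theorem subfnRestrict_binop (op : Bool → Bool → Bool) (Y : Set ι) (ρ : ι → Bool)
    (g h : (ι → Bool) → Bool) :
    subfnRestrict Y ρ (fun x => op (g x) (h x)) =
      fun x => op (subfnRestrict Y ρ g x) (subfnRestrict Y ρ h x) := rfl

section Measure

variable [Fintype ι]

/-- The finite set `S'_Y(g)`: all restrictions of `g` to the block `Y`, together with the two
constant functions. [cite: Jukna2012, §6.5 (PDF p. 188)] -/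
def subfnClosure (Y : Set ι) (g : (ι → Bool) → Bool) : Finset ((ι → Bool) → Bool) :=
  insert (fun _ => false) (insert (fun _ => true) (univ.image fun ρ : ι → Bool => subfnRestrict Y ρ g))

/-- The subfunction measure `ψ_Y(g)`: `|S'_Y(g)|`, except that a function all of whose
restrictions to `Y` are constant gets measure `1`. [cite: Jukna2012, Thm. 6.16 (PDF p. 188)] -/
def subfnMeasure (Y : Set ι) (g : (ι → Bool) → Bool) : ℕ :=
  if (subfnClosure Y g).card ≤ 2 then 1 else (subfnClosure Y g).card

variable (Y : Set ι) (g : (ι → Bool) → Bool)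

/-- Constants belong to `S'_Y(g)`. [folklore] -/
theorem const_mem_subfnClosure (b : Bool) : (fun _ => b) ∈ subfnClosure Y g := by
  cases b <;> simp [subfnClosure]

/-- Restrictions belong to `S'_Y(g)`. [folklore] -/
theorem subfnRestrict_mem_subfnClosure (ρ : ι → Bool) : subfnRestrict Y ρ g ∈ subfnClosure Y g := by
  simp only [subfnClosure, mem_insert, mem_image, mem_univ, true_and]
  exact Or.inr (Or.inr ⟨ρ, rfl⟩)

variable {Y g} in
/-- Membership in `S'_Y(g)`. [folklore] -/
theorem mem_subfnClosure_iff {h : (ι → Bool) → Bool} :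
    h ∈ subfnClosure Y g ↔ h = (fun _ => false) ∨ h = (fun _ => true) ∨ ∃ ρ, subfnRestrict Y ρ g = h := by
  simp only [subfnClosure, mem_insert, mem_image, mem_univ, true_and]

/-- `ψ_Y(g) ≥ 1`. [folklore] -/
theorem subfnMeasure_pos : 0 < subfnMeasure Y g := by
  unfold subfnMeasure
  split_ifs with h <;> omega

/-- `ψ_Y(g) ≤ |S'_Y(g)|`. [folklore] -/
theorem subfnMeasure_le_card : subfnMeasure Y g ≤ (subfnClosure Y g).card := by
  unfold subfnMeasure
  split_ifs with h
  · exact card_pos.2 ⟨_, const_mem_subfnClosure Y g false⟩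
  · exact le_rfl

variable {Y g} in
/-- `|S'_Y(g)| ≤ ψ_Y(g)` as soon as `g` has a non-constant restriction. [folklore] -/
theorem card_le_subfnMeasure (h : 2 < (subfnClosure Y g).card) :
    (subfnClosure Y g).card ≤ subfnMeasure Y g := by
  unfold subfnMeasure
  rw [if_neg (not_le.2 h)]

variable {Y g} in
/-- The measure is monotone under inclusion of the closures. [folklore] -/
theorem subfnMeasure_mono {h : (ι → Bool) → Bool} (hsub : subfnClosure Y g ⊆ subfnClosure Y h) :
    subfnMeasure Y g ≤ subfnMeasure Y h := by
  have hc := card_le_card hsub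
  unfold subfnMeasure
  split_ifs with h1 h2 <;> omega

variable {Y g} in
/-- A function with a non-constant restriction has at least three elements in `S'_Y`. [folklore] -/
theorem two_lt_card_subfnClosure (hg : ¬ ∀ ρ, ∃ b : Bool, subfnRestrict Y ρ g = fun _ => b) :
    2 < (subfnClosure Y g).card := by
  obtain ⟨ρ, hρ⟩ := not_forall.1 hg
  have hρ' : ∀ b : Bool, subfnRestrict Y ρ g ≠ fun _ => b := fun b hb => hρ ⟨b, hb⟩
  rw [Finset.two_lt_card_iff]
  refine ⟨fun _ => false, fun _ => true, subfnRestrict Y ρ g, const_mem_subfnClosure Y g false,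
    const_mem_subfnClosure Y g true, subfnRestrict_mem_subfnClosure Y g ρ, ?_, ?_, ?_⟩
  · exact fun h => Bool.false_ne_true (congrFun h fun _ => false)
  · exact fun h => hρ' false h.symm
  · exact fun h => hρ' true h.symm

/-- **The key inequality `ψ_Y(g ⋄ h) ≤ ψ_Y(g) · ψ_Y(h)`** for a binary connective `⋄` with
`b ⋄ b = b` whose sections at constants are constants or the identity (e.g. `∧`, `∨`): if every
restriction of `h` is constant, then every restriction of `g ⋄ h` is `0`, `1` or a restriction of
`g`; otherwise both measures are genuine cardinalities and restrictions of `g ⋄ h` are images of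
pairs (Jukna 2012, proof of Thm. 6.16, the subformula count). [cite: Jukna2012, Thm. 6.16 (PDF pp. 188–189)] -/
theorem subfnMeasure_binop_le (op : Bool → Bool → Bool) (h1 : ∀ b, op b b = b)
    (h2 : ∀ c, (∀ a, op a c = a) ∨ ∃ b, ∀ a, op a c = b)
    (h3 : ∀ c, (∀ a, op c a = a) ∨ ∃ b, ∀ a, op c a = b)
    (Y : Set ι) (g h : (ι → Bool) → Bool) :
    subfnMeasure Y (fun x => op (g x) (h x)) ≤ subfnMeasure Y g * subfnMeasure Y h := by
  have key := subfnRestrict_binop op Y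
  by_cases hh : ∀ ρ, ∃ b : Bool, subfnRestrict Y ρ h = fun _ => b
  · have hsub : subfnClosure Y (fun x => op (g x) (h x)) ⊆ subfnClosure Y g := by
      intro f hf
      rw [mem_subfnClosure_iff] at hf ⊢
      rcases hf with rfl | rfl | ⟨ρ, rfl⟩
      · exact Or.inl rfl
      · exact Or.inr (Or.inl rfl)
      · obtain ⟨b, hb⟩ := hh ρ
        rw [key, hb]
        rcases h2 b with hid | ⟨b', hb'⟩
        · exact Or.inr (Or.inr ⟨ρ, by funext x; simp [hid]⟩)
        · cases b'
          · exact Or.inl (by funext x; simp [hb'])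
          · exact Or.inr (Or.inl (by funext x; simp [hb']))
    calc subfnMeasure Y _ ≤ subfnMeasure Y g := subfnMeasure_mono hsub
      _ ≤ subfnMeasure Y g * subfnMeasure Y h :=
          Nat.le_mul_of_pos_right _ (subfnMeasure_pos Y h)
  by_cases hg : ∀ ρ, ∃ b : Bool, subfnRestrict Y ρ g = fun _ => b
  · have hsub : subfnClosure Y (fun x => op (g x) (h x)) ⊆ subfnClosure Y h := by
      intro f hf
      rw [mem_subfnClosure_iff] at hf ⊢
      rcases hf with rfl | rfl | ⟨ρ, rfl⟩
      · exact Or.inl rfl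
      · exact Or.inr (Or.inl rfl)
      · obtain ⟨b, hb⟩ := hg ρ
        rw [key, hb]
        rcases h3 b with hid | ⟨b', hb'⟩
        · exact Or.inr (Or.inr ⟨ρ, by funext x; simp [hid]⟩)
        · cases b'
          · exact Or.inl (by funext x; simp [hb'])
          · exact Or.inr (Or.inl (by funext x; simp [hb']))
    calc subfnMeasure Y _ ≤ subfnMeasure Y h := subfnMeasure_mono hsub
      _ ≤ subfnMeasure Y g * subfnMeasure Y h :=
          Nat.le_mul_of_pos_left _ (subfnMeasure_pos Y g)
  -- both `g` and `h` have non-constant restrictions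
  have hcg := two_lt_card_subfnClosure hg
  have hch := two_lt_card_subfnClosure hh
  calc subfnMeasure Y _ ≤ (subfnClosure Y (fun x => op (g x) (h x))).card := subfnMeasure_le_card Y _
    _ ≤ (image₂ (fun p q => fun x => op (p x) (q x)) (subfnClosure Y g) (subfnClosure Y h)).card := by
        refine card_le_card fun f hf => ?_
        rw [mem_subfnClosure_iff] at hf
        rw [mem_image₂]
        rcases hf with rfl | rfl | ⟨ρ, rfl⟩
        · exact ⟨_, const_mem_subfnClosure Y g false, _, const_mem_subfnClosure Y h false,
            by funext x; simp [h1]⟩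
        · exact ⟨_, const_mem_subfnClosure Y g true, _, const_mem_subfnClosure Y h true,
            by funext x; simp [h1]⟩
        · exact ⟨_, subfnRestrict_mem_subfnClosure Y g ρ, _, subfnRestrict_mem_subfnClosure Y h ρ,
            (key ρ g h).symm⟩
    _ ≤ (subfnClosure Y g).card * (subfnClosure Y h).card := card_image₂_le _ _ _
    _ ≤ subfnMeasure Y g * subfnMeasure Y h :=
        Nat.mul_le_mul (card_le_subfnMeasure hcg) (card_le_subfnMeasure hch)

/-- A projection `x ↦ x i` has measure at most `3` (`S'_Y ⊆ {0, 1, x ↦ x i}`). [folklore] -/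
theorem subfnMeasure_proj_le (Y : Set ι) (i : ι) : subfnMeasure Y (fun x => x i) ≤ 3 := by
  have hsub : subfnClosure Y (fun x => x i) ⊆ {fun _ => false, fun _ => true, fun x => x i} := by
    intro f hf
    rw [mem_subfnClosure_iff] at hf
    simp only [mem_insert, mem_singleton]
    rcases hf with rfl | rfl | ⟨ρ, rfl⟩
    · exact Or.inl rfl
    · exact Or.inr (Or.inl rfl)
    · by_cases hi : i ∈ Y
      · exact Or.inr (Or.inr (by funext x; simp [subfnRestrict, hi]))
      · cases hρ : ρ i
        · exact Or.inl (by funext x; simp [subfnRestrict, hi, hρ])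
        · exact Or.inr (Or.inl (by funext x; simp [subfnRestrict, hi, hρ]))
  have hc : (subfnClosure Y (fun x => x i)).card ≤ 3 := (card_le_card hsub).trans card_le_three
  unfold subfnMeasure
  split_ifs with h <;> omega

/-- A projection onto a variable outside the block has measure `1`. [folklore] -/
theorem subfnMeasure_proj_of_not_mem {Y : Set ι} {i : ι} (hi : i ∉ Y) :
    subfnMeasure Y (fun x => x i) = 1 := by
  have hsub : subfnClosure Y (fun x => x i) ⊆ {fun _ => false, fun _ => true} := by
    intro f hf
    rw [mem_subfnClosure_iff] at hf
    simp only [mem_insert, mem_singleton]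
    rcases hf with rfl | rfl | ⟨ρ, rfl⟩
    · exact Or.inl rfl
    · exact Or.inr rfl
    · cases hρ : ρ i
      · exact Or.inl (by funext x; simp [subfnRestrict, hi, hρ])
      · exact Or.inr (by funext x; simp [subfnRestrict, hi, hρ])
  have hc : (subfnClosure Y (fun x => x i)).card ≤ 2 := (card_le_card hsub).trans card_le_two
  simp [subfnMeasure, hc]

variable {Y g} in
/-- **Lower bound on the measure from an injective family of restrictions**: if `a ↦ g|_{ρ_a}`
is injective on a finite index type with more than two elements, then `ψ_Y(g) ≥ |α|`.
[cite: Jukna2012, Thm. 6.16 (PDF p. 188)] -/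
theorem card_le_subfnMeasure_of_injective {α : Type*} [Fintype α] (r : α → ι → Bool)
    (hinj : Function.Injective fun a => subfnRestrict Y (r a) g) (h2 : 2 < Fintype.card α) :
    Fintype.card α ≤ subfnMeasure Y g := by
  have hsub : (univ.image fun a => subfnRestrict Y (r a) g) ⊆ subfnClosure Y g := by
    intro f hf
    obtain ⟨a, -, rfl⟩ := mem_image.1 hf
    exact subfnRestrict_mem_subfnClosure Y g (r a)
  have hcard : (univ.image fun a => subfnRestrict Y (r a) g).card = Fintype.card α := by
    rw [card_image_of_injective _ hinj, card_univ]
  have hle : Fintype.card α ≤ (subfnClosure Y g).card := hcard ▸ card_le_card hsub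
  exact hle.trans (card_le_subfnMeasure (lt_of_lt_of_le h2 hle))

end Measure

/-! ### Gates over the monotone basis, reference counts -/

/-- A gate over `{∧₂, ∨₂}` is, literally, a binary `∧` or a binary `∨` gate. [folklore] -/
theorem Gate.exists_eq_of_fn_mem_monotoneBasis {g : Gate ι} (hg : g.fn ∈ monotoneBasis) :
    ∃ (op : (Fin 2 → Bool) → Bool) (args : Fin 2 → ι ⊕ ℕ), g = ⟨2, op, args⟩ ∧
      ((op = fun v => decide (∀ i, v i = true)) ∨ (op = fun v => decide (∃ i, v i = true))) := by
  obtain ⟨k, op, args⟩ := g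
  simp only [Gate.fn, monotoneBasis, GateFn.and, GateFn.or, Set.mem_insert_iff,
    Set.mem_singleton_iff, Sigma.mk.inj_iff] at hg
  rcases hg with ⟨rfl, h⟩ | ⟨rfl, h⟩
  · exact ⟨op, args, rfl, Or.inl (eq_of_heq h)⟩
  · exact ⟨op, args, rfl, Or.inr (eq_of_heq h)⟩

/-- The value of a binary `∧` gate. [folklore] -/
theorem gateValue_and_two (x : ι → Bool) (T : List Bool) (args : Fin 2 → ι ⊕ ℕ) :
    gateValue x T ⟨2, fun v => decide (∀ i, v i = true), args⟩ =
      (wireVal x T (args 0) && wireVal x T (args 1)) := by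
  simp [gateValue, Fin.forall_fin_two]

/-- The value of a binary `∨` gate. [folklore] -/
theorem gateValue_or_two (x : ι → Bool) (T : List Bool) (args : Fin 2 → ι ⊕ ℕ) :
    gateValue x T ⟨2, fun v => decide (∃ i, v i = true), args⟩ =
      (wireVal x T (args 0) || wireVal x T (args 1)) := by
  simp [gateValue, Fin.exists_fin_two]

namespace Circuit

/-- The reference count as a sum over gate indices. [folklore] -/
theorem refCount_eq_sum (C : Circuit ι) (m : ℕ) :
    C.refCount m = ∑ j : Fin C.gates.length,
      (univ.filter fun a : Fin (C.gates[(j : ℕ)]).arity => (C.gates[(j : ℕ)]).args a = .inr m).card := by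
  unfold refCount
  rw [← List.ofFn_getElem_eq_map, List.sum_ofFn]
  refine sum_congr rfl fun j _ => ?_
  congr 1
  ext a
  simp only [mem_filter, mem_univ, true_and, Sum.getRight?_eq_some_iff]

/-- In a formula, two distinct gates never reference the same gate. [folklore] -/
theorem IsFormula.false_of_ref_ref {C : Circuit ι} (hF : C.IsFormula) {p p' : ℕ}
    (hp : p < C.gates.length) (hp' : p' < C.gates.length) (hne : p ≠ p') {m : ℕ}
    (a : Fin (C.gates[p]).arity) (ha : (C.gates[p]).args a = .inr m)
    (a' : Fin (C.gates[p']).arity) (ha' : (C.gates[p']).args a' = .inr m) : False := by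
  set f := fun j : Fin C.gates.length =>
    (univ.filter fun a : Fin (C.gates[(j : ℕ)]).arity => (C.gates[(j : ℕ)]).args a = .inr m).card
    with hf
  have h1 : 1 ≤ f ⟨p, hp⟩ := card_pos.2 ⟨a, by simp [ha]⟩
  have h2 : 1 ≤ f ⟨p', hp'⟩ := card_pos.2 ⟨a', by simp [ha']⟩
  have hne' : (⟨p, hp⟩ : Fin C.gates.length) ≠ ⟨p', hp'⟩ := fun h => hne (Fin.mk.inj_iff.1 h)
  have hle : f ⟨p, hp⟩ + f ⟨p', hp'⟩ ≤ C.refCount m := by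
    rw [refCount_eq_sum, ← sum_pair hne']
    exact sum_le_sum_of_subset (subset_univ _)
  have := hF m
  omega

/-- In a formula, two distinct argument positions of a gate never reference the same gate. [folklore] -/
theorem IsFormula.false_of_two_slots {C : Circuit ι} (hF : C.IsFormula) {p : ℕ}
    (hp : p < C.gates.length) {m : ℕ} {a a' : Fin (C.gates[p]).arity} (hne : a ≠ a')
    (ha : (C.gates[p]).args a = .inr m) (ha' : (C.gates[p]).args a' = .inr m) : False := by
  set f := fun j : Fin C.gates.length =>
    (univ.filter fun a : Fin (C.gates[(j : ℕ)]).arity => (C.gates[(j : ℕ)]).args a = .inr m).card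
    with hf
  have h2 : 2 ≤ f ⟨p, hp⟩ := by
    have hsub : ({a, a'} : Finset (Fin (C.gates[p]).arity)) ⊆
        univ.filter fun b : Fin (C.gates[p]).arity => (C.gates[p]).args b = .inr m := by
      intro b hb
      simp only [mem_insert, mem_singleton] at hb
      rcases hb with rfl | rfl <;> simp [ha, ha']
    exact (card_pair hne).symm.le.trans (card_le_card hsub)
  have hle : f ⟨p, hp⟩ ≤ C.refCount m := by
    rw [refCount_eq_sum]
    exact single_le_sum (f := f) (fun _ _ => Nat.zero_le _) (mem_univ _)
  have := hF m
  omega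

/-! ### Wire functions -/

/-- The Boolean function carried by the wire `w` of `C` (an input variable or a gate). [cite: AroraBarak2009, Rem. 6.4] -/
def wireFn (C : Circuit ι) (w : ι ⊕ ℕ) : (ι → Bool) → Bool :=
  fun x => wireVal x (transcript x [] C.gates) w

/-- An input wire carries a projection. [folklore] -/
theorem wireFn_inl (C : Circuit ι) (i : ι) : C.wireFn (.inl i) = fun x => x i := rfl

/-- The circuit computes the function carried by its output wire. [folklore] -/
theorem eval_eq_wireFn (C : Circuit ι) : C.eval = C.wireFn C.output := by
  funext x
  exact eval_eq_wireVal C x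

/-- A gate wire carries the gate applied to the transcript (the gate equation). [cite: AroraBarak2009, Rem. 6.4] -/
theorem wireFn_inr (C : Circuit ι) {j : ℕ} (hj : j < C.gates.length) (x : ι → Bool) :
    C.wireFn (.inr j) x = gateValue x (transcript x [] C.gates) (C.gates[j]) :=
  getD_transcript_eq_gateValue C x j hj

/-! ### Unreferenced gates and the potential -/

/-- `U_m`: the gates `j < m` that are not referenced by any gate `p < m`. [folklore] -/
def unusedBelow (C : Circuit ι) (m : ℕ) : Finset ℕ :=
  (range m).filter fun j =>
    ∀ p, (hp : p < C.gates.length) → p < m → ∀ a : Fin (C.gates[p]).arity, (C.gates[p]).args a ≠ .inr j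

/-- Membership in `U_m`. [folklore] -/
theorem mem_unusedBelow {C : Circuit ι} {m j : ℕ} :
    j ∈ C.unusedBelow m ↔
      j < m ∧ ∀ p, (hp : p < C.gates.length) → p < m → ∀ a : Fin (C.gates[p]).arity, (C.gates[p]).args a ≠ .inr j := by
  unfold unusedBelow
  rw [mem_filter, mem_range]

/-- `m ∉ U_m`. [folklore] -/
theorem not_mem_unusedBelow_self (C : Circuit ι) (m : ℕ) : m ∉ C.unusedBelow m :=
  fun h => lt_irrefl _ (mem_unusedBelow.1 h).1

/-- A gate is unreferenced when it has just been added: `m ∈ U_{m+1}` (acyclicity). [folklore] -/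
theorem mem_unusedBelow_succ_self (C : Circuit ι) (m : ℕ) : m ∈ C.unusedBelow (m + 1) := by
  rw [mem_unusedBelow]
  refine ⟨Nat.lt_succ_self m, fun p hp hpm a ha => ?_⟩
  have := C.wf p hp a m ha
  omega

/-- The recursion `U_{m+1} = {m} ∪ (U_m ∖ args(m))`. [folklore] -/
theorem unusedBelow_succ (C : Circuit ι) {m : ℕ} (hm : m < C.gates.length) :
    C.unusedBelow (m + 1) =
      insert m ((C.unusedBelow m).filter fun j => ∀ a : Fin (C.gates[m]).arity, (C.gates[m]).args a ≠ .inr j) := by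
  ext j
  rw [mem_insert, mem_filter, mem_unusedBelow, mem_unusedBelow]
  constructor
  · rintro ⟨hj, H⟩
    rcases Nat.lt_succ_iff_lt_or_eq.1 hj with hj' | rfl
    · exact Or.inr ⟨⟨hj', fun p hp hpm a => H p hp (Nat.lt_succ_of_lt hpm) a⟩,
        fun a => H m hm (Nat.lt_succ_self m) a⟩
    · exact Or.inl rfl
  · rintro (rfl | ⟨⟨hj, H⟩, H'⟩)
    · exact mem_unusedBelow.1 (C.mem_unusedBelow_succ_self _)
    · refine ⟨Nat.lt_succ_of_lt hj, fun p hp hpm a => ?_⟩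
      rcases Nat.lt_succ_iff_lt_or_eq.1 hpm with hpm' | rfl
      · exact H p hp hpm' a
      · exact H' a

/-- In a formula, a gate argument of gate `m` lies in `U_m` and is referenced by gate `m`. [folklore] -/
theorem IsFormula.arg_mem_filter_unusedBelow {C : Circuit ι} (hF : C.IsFormula) {m : ℕ}
    (hm : m < C.gates.length) {g : Gate ι} (hg : C.gates[m] = g) (a : Fin g.arity) {j : ℕ}
    (ha : g.args a = .inr j) :
    j ∈ (C.unusedBelow m).filter fun j => ¬ ∀ a : Fin (C.gates[m]).arity, (C.gates[m]).args a ≠ .inr j := by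
  subst hg
  rw [mem_filter, mem_unusedBelow]
  refine ⟨⟨C.wf m hm a j ha, fun p hp hpm a' ha' => ?_⟩, fun h => h a ha⟩
  exact hF.false_of_ref_ref hp hm (Nat.ne_of_lt hpm) a' ha' a ha

/-- In a formula, two argument positions of a gate pointing at gates point at distinct gates. [folklore] -/
theorem IsFormula.ne_of_args {C : Circuit ι} (hF : C.IsFormula) {m : ℕ}
    (hm : m < C.gates.length) {g : Gate ι} (hg : C.gates[m] = g) {a a' : Fin g.arity}
    (hne : a ≠ a') {j j' : ℕ} (ha : g.args a = .inr j) (ha' : g.args a' = .inr j') : j ≠ j' := by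
  subst hg
  rintro rfl
  exact hF.false_of_two_slots hm hne ha ha'

section Potential

variable [Fintype ι] {κ : Type*} [Fintype κ]

/-- `Ψ(w) = ∏ₖ ψ_{Y_k}(w)`: the product of the block measures of the function on wire `w`. [cite: Jukna2012, Thm. 6.16 (PDF p. 188)] -/
def blockMeasure (C : Circuit ι) (Y : κ → Set ι) (w : ι ⊕ ℕ) : ℕ :=
  ∏ k, subfnMeasure (Y k) (C.wireFn w)

/-- `Ψ(w) ≥ 1`. [folklore] -/
theorem blockMeasure_pos (C : Circuit ι) (Y : κ → Set ι) (w : ι ⊕ ℕ) : 0 < C.blockMeasure Y w :=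
  prod_pos fun _ _ => subfnMeasure_pos _ _

/-- **Gate step**: for an `∧`/`∨` gate `m` with arguments `u, v`, `Ψ(m) ≤ Ψ(u) · Ψ(v)`. [cite: Jukna2012, Thm. 6.16 (PDF pp. 188–189)] -/
theorem blockMeasure_inr_le (C : Circuit ι) (Y : κ → Set ι) {m : ℕ} (hm : m < C.gates.length)
    {op : (Fin 2 → Bool) → Bool} {args : Fin 2 → ι ⊕ ℕ} (hg : C.gates[m] = ⟨2, op, args⟩)
    (hop : (op = fun v => decide (∀ i, v i = true)) ∨ (op = fun v => decide (∃ i, v i = true))) :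
    C.blockMeasure Y (.inr m) ≤ C.blockMeasure Y (args 0) * C.blockMeasure Y (args 1) := by
  have hw : (C.wireFn (.inr m) = fun x => (C.wireFn (args 0) x && C.wireFn (args 1) x)) ∨
      (C.wireFn (.inr m) = fun x => (C.wireFn (args 0) x || C.wireFn (args 1) x)) := by
    rcases hop with rfl | rfl
    · left; funext x; rw [C.wireFn_inr hm, hg, gateValue_and_two]; rfl
    · right; funext x; rw [C.wireFn_inr hm, hg, gateValue_or_two]; rfl
  unfold blockMeasure
  rw [← prod_mul_distrib]
  refine prod_le_prod (fun k _ => Nat.zero_le _) fun k _ => ?_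
  rcases hw with hw | hw <;> rw [hw]
  · exact subfnMeasure_binop_le (fun a b => a && b) (by decide) (by decide) (by decide) _ _ _
  · exact subfnMeasure_binop_le (fun a b => a || b) (by decide) (by decide) (by decide) _ _ _

/-- **Leaf step**: for pairwise disjoint blocks `Y_k = blk⁻¹ k`, an input wire has `Ψ ≤ 3`. [cite: Jukna2012, Thm. 6.16 (PDF pp. 188–189)] -/
theorem blockMeasure_inl_le (C : Circuit ι) (blk : ι → Option κ) (i : ι) :
    C.blockMeasure (fun k => {i | blk i = some k}) (.inl i) ≤ 3 := by
  unfold blockMeasure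
  rw [wireFn_inl]
  cases hb : blk i with
  | none =>
    rw [prod_eq_one (fun k _ => subfnMeasure_proj_of_not_mem (by simp [hb]))]
    norm_num
  | some k₀ =>
    rw [prod_eq_single k₀ (fun k _ hk => subfnMeasure_proj_of_not_mem (by
        simp only [Set.mem_setOf_eq, hb, Option.some.injEq]; exact fun h => hk h.symm))
      (fun h => absurd (mem_univ k₀) h)]
    exact subfnMeasure_proj_le _ _

/-- The potential `Φ_m = ∏_{j ∈ U_m} Ψ(j)`. [folklore] -/
def blockPotential (C : Circuit ι) (Y : κ → Set ι) (m : ℕ) : ℕ :=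
  ∏ j ∈ C.unusedBelow m, C.blockMeasure Y (.inr j)

/-- **Potential step**: in a formula over `{∧₂, ∨₂}`, `Φ_{m+1} ≤ 9 · Φ_m` — gate `m` consumes its
distinct, previously unreferenced gate arguments and each variable argument costs a factor `≤ 3`.
[cite: Jukna2012, Thm. 6.16 (PDF pp. 188–189)] -/
theorem blockPotential_succ_le (C : Circuit ι) (hO : C.IsOver monotoneBasis) (hF : C.IsFormula)
    (blk : ι → Option κ) {m : ℕ} (hm : m < C.gates.length) :
    C.blockPotential (fun k => {i | blk i = some k}) (m + 1) ≤
      9 * C.blockPotential (fun k => {i | blk i = some k}) m := by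
  set Y : κ → Set ι := fun k => {i | blk i = some k} with hY
  obtain ⟨op, args, hg, hop⟩ :=
    Gate.exists_eq_of_fn_mem_monotoneBasis (hO _ (List.getElem_mem hm))
  set P : ℕ → Prop := fun j => ∀ a : Fin (C.gates[m]).arity, (C.gates[m]).args a ≠ .inr j with hP
  set B := ∏ j ∈ (C.unusedBelow m).filter (fun j => ¬ P j), C.blockMeasure Y (.inr j) with hB
  have hBpos : 0 < B := prod_pos fun _ _ => C.blockMeasure_pos Y _
  have hmem : ∀ (a : Fin 2) (j : ℕ), args a = .inr j →
      j ∈ (C.unusedBelow m).filter (fun j => ¬ P j) := fun a j ha =>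
    hF.arg_mem_filter_unusedBelow hm hg a ha
  have hle_one : ∀ j, j ∈ (C.unusedBelow m).filter (fun j => ¬ P j) →
      C.blockMeasure Y (.inr j) ≤ B := fun j hj =>
    Nat.le_of_dvd hBpos (dvd_prod_of_mem _ hj)
  -- the new gate costs at most `9 · B`
  have hgate : C.blockMeasure Y (.inr m) ≤ 9 * B := by
    refine (C.blockMeasure_inr_le Y hm hg hop).trans ?_
    rcases h0 : args 0 with i | j <;> rcases h1 : args 1 with i' | j'
    · calc C.blockMeasure Y (.inl i) * C.blockMeasure Y (.inl i') ≤ 3 * 3 :=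
            Nat.mul_le_mul (C.blockMeasure_inl_le blk i) (C.blockMeasure_inl_le blk i')
        _ ≤ 9 * B := by omega
    · calc C.blockMeasure Y (.inl i) * C.blockMeasure Y (.inr j') ≤ 3 * B :=
            Nat.mul_le_mul (C.blockMeasure_inl_le blk i) (hle_one j' (hmem 1 j' h1))
        _ ≤ 9 * B := by omega
    · calc C.blockMeasure Y (.inr j) * C.blockMeasure Y (.inl i') ≤ B * 3 :=
            Nat.mul_le_mul (hle_one j (hmem 0 j h0)) (C.blockMeasure_inl_le blk i')
        _ ≤ 9 * B := by omega
    · have hne : j ≠ j' := hF.ne_of_args hm hg (show (0 : Fin 2) ≠ 1 by decide) h0 h1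
      have hsub : ({j, j'} : Finset ℕ) ⊆ (C.unusedBelow m).filter (fun j => ¬ P j) := by
        intro b hb
        simp only [mem_insert, mem_singleton] at hb
        rcases hb with rfl | rfl
        · exact hmem 0 _ h0
        · exact hmem 1 _ h1
      calc C.blockMeasure Y (.inr j) * C.blockMeasure Y (.inr j')
            = ∏ b ∈ ({j, j'} : Finset ℕ), C.blockMeasure Y (.inr b) :=
              (prod_pair (f := fun b => C.blockMeasure Y (.inr b)) hne).symm
        _ ≤ B := Nat.le_of_dvd hBpos (prod_dvd_prod_of_subset _ _ _ hsub)
        _ ≤ 9 * B := by omega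
  unfold blockPotential
  rw [C.unusedBelow_succ hm, prod_insert (fun h => C.not_mem_unusedBelow_self m (mem_filter.1 h).1),
    ← prod_filter_mul_prod_filter_not (C.unusedBelow m) P]
  calc C.blockMeasure Y (.inr m) * ∏ j ∈ (C.unusedBelow m).filter P, C.blockMeasure Y (.inr j)
      ≤ (9 * B) * ∏ j ∈ (C.unusedBelow m).filter P, C.blockMeasure Y (.inr j) :=
        Nat.mul_le_mul_right _ hgate
    _ = 9 * ((∏ j ∈ (C.unusedBelow m).filter P, C.blockMeasure Y (.inr j)) * B) := by ring

/-- **The potential bound `Φ_m ≤ 9 ^ m`.** [cite: Jukna2012, Thm. 6.16 (PDF pp. 188–189)] -/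
theorem blockPotential_le (C : Circuit ι) (hO : C.IsOver monotoneBasis) (hF : C.IsFormula)
    (blk : ι → Option κ) : ∀ m, m ≤ C.gates.length →
      C.blockPotential (fun k => {i | blk i = some k}) m ≤ 9 ^ m
  | 0, _ => by simp [blockPotential, unusedBelow]
  | m + 1, h => by
    calc _ ≤ 9 * C.blockPotential (fun k => {i | blk i = some k}) m :=
          C.blockPotential_succ_le hO hF blk h
      _ ≤ 9 * 9 ^ m := Nat.mul_le_mul_left 9 (blockPotential_le C hO hF blk m (Nat.le_of_succ_le h))
      _ = 9 ^ (m + 1) := by rw [pow_succ, mul_comm]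

/-- **Nechiporuk's counting lemma for monotone formulas (crude constant).** For a formula `C` over
`{∧₂, ∨₂}` and pairwise disjoint blocks of variables `Y_k = blk⁻¹(k)`, the product over the blocks
of the subfunction measures of the computed function is at most `3 ^ (2 · size + 1)`; i.e.
`Σₖ log₃ ψ_{Y_k}(f) ≤ 2 · size(C) + 1` (Jukna 2012, Thm. 6.16, with `¼ · Σ log₂ sᵢ ≤ leaves` there).
[cite: Jukna2012, Thm. 6.16 (PDF pp. 188–189)] -/
theorem prod_subfnMeasure_eval_le (C : Circuit ι) (hO : C.IsOver monotoneBasis)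
    (hF : C.IsFormula) (blk : ι → Option κ) :
    ∏ k, subfnMeasure {i | blk i = some k} C.eval ≤ 3 ^ (2 * C.size + 1) := by
  rw [C.eval_eq_wireFn]
  change C.blockMeasure (fun k => {i | blk i = some k}) C.output ≤ _
  have h3 : 0 < 3 := by norm_num
  cases hco : C.output with
  | inl i =>
    calc _ ≤ 3 := C.blockMeasure_inl_le blk i
      _ = 3 ^ 1 := by norm_num
      _ ≤ 3 ^ (2 * C.size + 1) := Nat.pow_le_pow_right h3 (by omega)
  | inr o =>
    have ho := C.wf_output o hco
    calc C.blockMeasure _ (.inr o)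
        ≤ C.blockPotential (fun k => {i | blk i = some k}) (o + 1) :=
          Nat.le_of_dvd (prod_pos fun _ _ => C.blockMeasure_pos _ _)
            (dvd_prod_of_mem _ (C.mem_unusedBelow_succ_self o))
      _ ≤ 9 ^ (o + 1) := C.blockPotential_le hO hF blk (o + 1) ho
      _ ≤ 9 ^ C.size := Nat.pow_le_pow_right (by norm_num) ho
      _ = 3 ^ (2 * C.size) := by rw [pow_mul]; norm_num
      _ ≤ 3 ^ (2 * C.size + 1) := Nat.pow_le_pow_right h3 (Nat.le_succ _)

end Potential

end Circuit

end Literature.Computability.Complexity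

end
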